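import Summits.QuantumFields.YangMills.Theorems.BalabanUVNodesN13NormalisationUpperSlopeThresholdAtRecord13SepCoPHV

/-!
# BalabanUVNodes ∕ N13 — THE SHARP LOWER COUPLING-SLOPE THRESHOLD OF THE NORMALISATION: letters growing like `a·log(1∕g_j)·|T^{(j)*}|` with `4a < d(𝔤)` are refuted by (B) + END once the
# couplings of the first `j₀` scales stay comparable from ABOVE; with p647277 the slope band COLLAPSES to print's point `a = d(𝔤)∕4`

(Track A, DAG node N13 = [B16]; cluster K1 — K1⁹ `StabilityBRunRowsAtRecordR13SepCoPHV` = stmt-QuantumFields-27364, helper; seat `pub-ymgap-dag-n13-w3` g6, INTENT-6; 2026-08-28; count-neutral.)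

THE POINT (LOCATED, count-neutral).  p640937 (g5) refuted letters of log-slope `a` with `2(1−L⁻⁴)(d(𝔤)−a) − (3∕2)d(𝔤) > 0`, a hair below `d(𝔤)∕4`: its §1 dropped EVERY scale `j ≥ 1` in
`E(P) = Σ_j [d(𝔤) log g_j + log σ₀ + …]·|T^{(j)*}|` (only `log g_j ≤ 0` was known there).  Under (H_up) — UPPER COUPLING COMPARABILITY `g_j⁻² ≥ g₀⁻² − B_j` along `γ_c`-windowed runs with a
fixed non-decreasing `B : ℕ → ℝ` (K1⁹'s row (i) `|β_k − b_k| ≤ r` with (0.20) gives it with `B_j = Σ_{i<j}(b_i + r)⁺`; the cone sequel derives it) — the first `j₀` scales have `g_j² ≤ 2g₀²`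
as soon as `g₀² B_{j₀} ≤ ½`, and they carry the weight `4(1 − L^{−4j₀})|T₁^{(0)}|` of `E`; so the threshold becomes `4a < d(𝔤)` EXACTLY (choose `j₀` with `16 L^{−4j₀}(d−a) ≤ d − 4a`).
With the UPPER threshold `4a > d(𝔤)` of p647277 (modulo the last-step floor (H_low) and (H_cmp)), TWO-SIDED letters of slope `a` are possible only at `a = d(𝔤)∕4`: print's value.
* §1 `card_site_zero_eq_pow_mul` (`|T₁^{(0)}| = L^{4j₀}·|T₁^{(j₀)}|`, `j₀ ≤ K`), `EOfRecord₁₃_le_of_logSlope_keepScales` — `K ≥ j₀`, `0 < g_j ≤ γ ≤ 1`, `log g₀ ≤ −½`, and `log g_j ≤ log g₀ + ½` for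
  `j < j₀` ⟹ `E(P) ≤ 4(d(𝔤)−a)(log g₀ + ½)(1 − L^{−4j₀})|T₁^{(0)}| + 4(|log σ₀| + C_w)|T₁^{(0)}|`.
* §2 ★★★ `false_of_endStatementBPrinted_of_endpointExistence_of_logSlope_sharp` — `a ≤ d(𝔤)`, `4a < d(𝔤)`, `0 ≤ C_w`; letters of slope AT MOST `a` + (H_up) + (B)(datumⱽ) + END ⟹ `False`.
  ROAD: `κ″ = d − 4a`; `j₀ = ⌈16(d−a)∕κ″⌉` (so `4(d−a)L^{−4j₀} ≤ κ″∕4` by `L^{4j₀} ≥ j₀`); END gives `g` and runs for all `K`; for `K ≥ max(j₀, 4d∕κ″, 2|ep g|)` and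
  `γ ≤ min(e^{−½}, (2B⁺_{j₀})^{−1∕2}·…, e^{−2C∕κ″})`: `(κ″∕2)·X ≤ C − ½` against `(κ″∕2)X ≥ C` (`X = log g₀⁻¹`; lower bound on `log Z` = p639903, upper window half = p625602).
* §3 ★★★ `four_mul_slope_eq_dim_of_endStatementBPrinted_of_endpointExistence` — TWO-SIDED letters of slope `a` + (H_up) + (H_cmp) + (H_low) + (B) + END ⟹ `4a = d(𝔤)`.
HONEST FRAMING: count-neutral; nothing of Bałaban's asserted or refuted — the excluded classes are the TREE's numerics slots, under displayed (H_up) (and (H_cmp), (H_low) in §3); K1⁹ NEITHER proved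
NOR refuted; no skeleton ∕ route text changed; N13 NOT discharged; counts UNMOVED (typed 28∕28 · discharged 5∕27 · A 5∕28); R4 closes the conditional finite-𝕋⁴ rung `BalabanLadder.UV` only — the
Yang–Mills mass gap (Clay) is NOT proved by any of this; nothing continuum ∕ ℝ⁴ ∕ OS.  No `sorry`, `def`, `instance`, `notation`.
-/

noncomputable section

open MeasureTheory
open scoped BigOperators

namespace Summit.QuantumFields.YangMills.BalabanUVNodes.N13NormalisationSharpLowerSlopeThresholdAtRecord13SepCoPHV

open Literature.MathematicalPhysics.QuantumFieldTheory.Balaban1983to89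
open Literature.MathematicalPhysics.QuantumFieldTheory.Balaban1983to89.T4Continuum
open Literature.MathematicalPhysics.QuantumFieldTheory.Balaban1983to89.Node00
open Literature.MathematicalPhysics.QuantumFieldTheory.Balaban1983to89.FlowStepRuns (genSeq genSeq_zero)
open Missing T4StabilitySocket
open Summit.QuantumFields.YangMills.BalabanUVNodes.N13UV01LevelZeroAtRecord13 (tstarCount_P_nonneg sum_tstarCount_P_range sum_tstarCount_P_range_le)
open Summit.QuantumFields.YangMills.BalabanUVNodes.N13GaugeFixingAxialLayers (log_partitionFn_ge_axialLayers_specialUnitary_d4)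
open Summit.QuantumFields.YangMills.BalabanUVNodes.N13NormalisationWindowOfCor3AtRecord13SepCoPHV (log_partitionFn_sub_E_le_of_cor3With)
open Summit.QuantumFields.YangMills.BalabanUVNodes.N13NormalisationNoGoCouplingBlindAtRecord13SepCoPHV (dimSU_cast card_site_zero_eq card_site_top_pos le_L_pow)
open Summit.QuantumFields.YangMills.BalabanUVNodes.N13NormalisationSlopeThresholdAtRecord13SepCoPHV (le_sitesPerDir_zero)
open Summit.QuantumFields.YangMills.BalabanUVNodes.N13NormalisationUpperSlopeThresholdAtRecord13SepCoPHV
  (false_of_endStatementBPrinted_of_endpointExistence_of_logSlopeLower)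

variable {F : T4Family} {N : ℕ} [NeZero N]

/-! ## §1. Keeping the first `j₀` scales in `E(P)` -/

section EBound

variable (θ : Stage13Params F N) (P : B12.RunParams)

omit [NeZero N] in
/-- **`|T₁^{(0)}| = L^{4j₀}·|T₁^{(j₀)}|`** on the `K`-th torus for `j₀ ≤ K` (`|T₁^{(j)}| = (2L^{m+K−j})⁴`). [cite: Balaban1987RG1, (0.1) p.251 (bookkeeping)] -/
theorem card_site_zero_eq_pow_mul (K j₀ : ℕ) (hj : j₀ ≤ K) :
    (Fintype.card (Site (F.P K) 0) : ℝ) = ((F.L : ℝ) ^ j₀) ^ 4 * (Fintype.card (Site (F.P K) j₀) : ℝ) := by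
  have h0 : Fintype.card (Site (F.P K) 0) = (2 * F.L ^ (F.m + K)) ^ 4 := by
    rw [Site.card_site]; simp [Params.sitesPerDir]
  have hj' : Fintype.card (Site (F.P K) j₀) = (2 * F.L ^ (F.m + K - j₀)) ^ 4 := by
    rw [Site.card_site]; simp [Params.sitesPerDir]
  have hsplit : F.L ^ (F.m + K) = F.L ^ j₀ * F.L ^ (F.m + K - j₀) := by
    rw [← pow_add]; congr 1; omega
  rw [h0, hj', hsplit]; push_cast; ring

/-- **`E(P)` OF A SLOPE-`a` WITNESS, KEEPING THE FIRST `j₀` SCALES** (`j₀ ≤ K`, `0 < g_j ≤ γ ≤ 1`, `a ≤ d(𝔤)`, `0 ≤ C_w`, `log g₀ ≤ −½`, and `log g_j ≤ log g₀ + ½` for `j < j₀`):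
if for `j < K` `−logz_j·(L⁴−1)|T₁^{(j+1)}| + Efl_j ≤ (a·(−log g_j) + C_w)·|T^{(j)*}|`, then
`E(P) ≤ 4(d(𝔤) − a)(log g₀ + ½)(1 − L^{−4j₀})·|T₁^{(0)}| + 4(|log σ₀| + C_w)·|T₁^{(0)}|` (scales `j ≥ j₀` dropped by `log g_j ≤ 0`; `Σ_{j<j₀}|T^{(j)*}| = 4(|T₁^{(0)}| − |T₁^{(j₀)}|)`).
[cite: Balaban1988Convergent, (1.15) p.249, Thm 1 p.262 (the shape of `E`; bookkeeping); Balaban1987RG1, (0.15) p.254] -/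
theorem EOfRecord₁₃_le_of_logSlope_keepScales {a Cw : ℝ} (ha : a ≤ ((dimSU N : ℕ) : ℝ)) (hCw : 0 ≤ Cw) (j₀ : ℕ) (hj₀ : j₀ ≤ P.K)
    (hw : ∀ j, j < P.K → 0 < gOfRecord₁₃ F N θ P j → gOfRecord₁₃ F N θ P j ≤ 1 →
      -(θ.logz P j) * ((((F.P P.K).L : ℝ) ^ 4 - 1) * sitesCard (F.P P.K) (j + 1)) + θ.Efl P j ≤
        (a * (-Real.log (gOfRecord₁₃ F N θ P j)) + Cw) * tstarCount (F.P P.K) j)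
    (hup : ∀ j, j < j₀ → Real.log (gOfRecord₁₃ F N θ P j) ≤ Real.log P.g0 + 1 / 2) (hg0 : Real.log P.g0 ≤ -(1 / 2))
    {γ : ℝ} (hγ : γ ≤ 1) (hI : ∀ k, k ≤ P.K → 0 < gOfRecord₁₃ F N θ P k ∧ gOfRecord₁₃ F N θ P k ≤ γ) :
    EOfRecord₁₃ F N θ P ≤ 4 * (((dimSU N : ℕ) : ℝ) - a) * (Real.log P.g0 + 1 / 2) * (1 - (((F.L : ℝ) ^ j₀) ^ 4)⁻¹) * (Fintype.card (Site (F.P P.K) 0) : ℝ)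
      + 4 * (|θ.ν.logσ₀| + Cw) * (Fintype.card (Site (F.P P.K) 0) : ℝ) := by
  have hE : EOfRecord₁₃ F N θ P = ∑ j ∈ Finset.range P.K, eStepOfRecord N θ.ν (θ.Efl P) (θ.logz P) (gOfRecord₁₃ F N θ P) (F.P P.K) j := rfl
  set d : ℝ := ((dimSU N : ℕ) : ℝ) with hd
  have hda : 0 ≤ d - a := by linarith
  set c : ℝ := (d - a) * (Real.log P.g0 + 1 / 2) with hc
  have hc0 : c ≤ 0 := mul_nonpos_of_nonneg_of_nonpos hda (by linarith)
  -- per-step bound: `e_j ≤ (if j < j₀ then c else 0)·t_j + (|log σ₀| + C_w)·t_j`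
  have hstep : ∀ j ∈ Finset.range P.K, eStepOfRecord N θ.ν (θ.Efl P) (θ.logz P) (gOfRecord₁₃ F N θ P) (F.P P.K) j ≤
      c * (if j < j₀ then tstarCount (F.P P.K) j else 0) + (|θ.ν.logσ₀| + Cw) * tstarCount (F.P P.K) j := by
    intro j hj
    have hjK : j < P.K := Finset.mem_range.mp hj
    have hg := hI j hjK.le
    have hlog : Real.log (gOfRecord₁₃ F N θ P j) ≤ 0 := Real.log_nonpos hg.1.le (hg.2.trans hγ)
    have hT : 0 ≤ tstarCount (F.P P.K) j := tstarCount_P_nonneg (F := F) (by simp; omega)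
    have hwj := hw j hjK hg.1 (hg.2.trans hγ)
    have hσ : θ.ν.logσ₀ * tstarCount (F.P P.K) j ≤ |θ.ν.logσ₀| * tstarCount (F.P P.K) j :=
      mul_le_mul_of_nonneg_right (le_abs_self _) hT
    unfold eStepOfRecord
    rw [← hd]
    by_cases hjj : j < j₀
    · rw [if_pos hjj]
      have hdl : (d - a) * Real.log (gOfRecord₁₃ F N θ P j) * tstarCount (F.P P.K) j ≤ c * tstarCount (F.P P.K) j := by
        rw [hc]; exact mul_le_mul_of_nonneg_right (mul_le_mul_of_nonneg_left (hup j hjj) hda) hT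
      nlinarith [hwj, hσ, hdl, hT]
    · rw [if_neg hjj, mul_zero, zero_add]
      have hneg : (d - a) * (Real.log (gOfRecord₁₃ F N θ P j) * tstarCount (F.P P.K) j) ≤ 0 :=
        mul_nonpos_of_nonneg_of_nonpos hda (mul_nonpos_of_nonpos_of_nonneg hlog hT)
      nlinarith [hwj, hσ, hneg, hT]
  rw [hE]
  refine (Finset.sum_le_sum hstep).trans ?_
  rw [Finset.sum_add_distrib, ← Finset.mul_sum, ← Finset.mul_sum]
  -- the kept scales: `Σ_{j<K} [j<j₀] t_j = Σ_{j<j₀} t_j = 4(|T₁^{(0)}| − |T₁^{(j₀)}|)`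
  have hkept : ∑ j ∈ Finset.range P.K, (if j < j₀ then tstarCount (F.P P.K) j else 0) =
      4 * (Fintype.card (Site (F.P P.K) 0) : ℝ) - 4 * (Fintype.card (Site (F.P P.K) j₀) : ℝ) := by
    rw [← Finset.sum_range_add_sum_Ico _ hj₀]
    have h1 : ∑ j ∈ Finset.range j₀, (if j < j₀ then tstarCount (F.P P.K) j else 0) = ∑ j ∈ Finset.range j₀, tstarCount (F.P P.K) j :=
      Finset.sum_congr rfl fun j hj => if_pos (Finset.mem_range.1 hj)
    have h2 : ∑ j ∈ Finset.Ico j₀ P.K, (if j < j₀ then tstarCount (F.P P.K) j else 0) = 0 :=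
      Finset.sum_eq_zero fun j hj => if_neg (not_lt.2 (Finset.mem_Ico.1 hj).1)
    rw [h1, h2, add_zero, sum_tstarCount_P_range (F := F) P.K j₀]
    unfold sitesCard
    ring
  have hsum : (|θ.ν.logσ₀| + Cw) * ∑ j ∈ Finset.range P.K, tstarCount (F.P P.K) j ≤ (|θ.ν.logσ₀| + Cw) * (4 * (Fintype.card (Site (F.P P.K) 0) : ℝ)) :=
    mul_le_mul_of_nonneg_left (sum_tstarCount_P_range_le (F := F) P.K P.K) (by positivity)
  have hcard := card_site_zero_eq_pow_mul (F := F) P.K j₀ hj₀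
  have hL : (0 : ℝ) < ((F.L : ℝ) ^ j₀) ^ 4 := by
    have : (0 : ℝ) < F.L := by exact_mod_cast (lt_trans zero_lt_one F.hL.2)
    positivity
  have hj0card : (Fintype.card (Site (F.P P.K) j₀) : ℝ) = (((F.L : ℝ) ^ j₀) ^ 4)⁻¹ * (Fintype.card (Site (F.P P.K) 0) : ℝ) := by
    rw [hcard, ← mul_assoc, inv_mul_cancel₀ hL.ne', one_mul]
  rw [hkept, hj0card]
  have e1 : c * (4 * (Fintype.card (Site (F.P P.K) 0) : ℝ) - 4 * ((((F.L : ℝ) ^ j₀) ^ 4)⁻¹ * (Fintype.card (Site (F.P P.K) 0) : ℝ))) =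
      4 * (d - a) * (Real.log P.g0 + 1 / 2) * (1 - (((F.L : ℝ) ^ j₀) ^ 4)⁻¹) * (Fintype.card (Site (F.P P.K) 0) : ℝ) := by rw [hc]; ring
  rw [e1]
  linarith [hsum]

end EBound

/-! ## §2. The sharp lower slope threshold -/

section NoGo

variable (θ : Stage13HParams F N) (h : θ.Provisos₁₃SepCoPH F N) (v : Revision₁₃ F N θ h)
set_option maxHeartbeats 400000 in
/-- **★★★ THE SHARP LOWER SLOPE THRESHOLD.**  Let `d = d(𝔰𝔲(N))`, `a ≤ d`, `4a < d`, `0 ≤ C_w`; suppose the witness's numerics slots have LOG-SLOPE AT MOST `a` in the weak-coupling regime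
(`−logz_p(j)·(L⁴−1)|T₁^{(j+1)}| + Efl_p(j) ≤ (a·(−log g_j) + C_w)·|T^{(j)*}|`), and (H_up): along every `γ_c`-windowed run `g_j⁻² ≥ g₀⁻² − B_j` for a fixed non-decreasing `B`.  Then (B) at the
revised datum and endpoint existence are JOINTLY CONTRADICTORY — p640937 with its `L⁻⁴` loss removed.  LOCATED; (H_up) displayed (the cone sequel derives it from K1⁹'s row (i)).
[cite: Balaban1988Convergent, Thm 1 p.262, (1.15) p.249, Cor. 3 (2.50) p.264; Balaban1987RG1, Thm 2 p.259, (0.15) p.254, (0.20) p.256] -/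
theorem false_of_endStatementBPrinted_of_endpointExistence_of_logSlope_sharp {a Cw γc : ℝ} {B : ℕ → ℝ} (ha : a ≤ ((dimSU N : ℕ) : ℝ))
    (hκ : 4 * a < ((dimSU N : ℕ) : ℝ)) (hCw : 0 ≤ Cw) (hγc : 0 < γc) (hB : Monotone B)
    (hw : ∀ (p : B12.RunParams) (j : ℕ), j < p.K → 0 < gOfRecord₁₃ F N θ.toStage13Params p j → gOfRecord₁₃ F N θ.toStage13Params p j ≤ 1 →
      -(θ.logz p j) * ((((F.P p.K).L : ℝ) ^ 4 - 1) * sitesCard (F.P p.K) (j + 1)) + θ.Efl p j ≤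
        (a * (-Real.log (gOfRecord₁₃ F N θ.toStage13Params p j)) + Cw) * tstarCount (F.P p.K) j)
    (hup : ∀ p : B12.RunParams, (∀ k, k ≤ p.K → 0 < gOfRecord₁₃ F N θ.toStage13Params p k ∧ gOfRecord₁₃ F N θ.toStage13Params p k ≤ γc) →
      ∀ j, j ≤ p.K → 1 / p.g0 ^ 2 - B j ≤ 1 / gOfRecord₁₃ F N θ.toStage13Params p j ^ 2)
    (hBst : B16.EndStatementBPrinted (datumOfRecord₁₃SepCoPHV F N θ h v).C)
    (hE : DagBinding.EndpointExistence (datumOfRecord₁₃SepCoPHV F N θ h v).C.toB12) : False := by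
  obtain ⟨-, γB, hγB, em, ep, hcor⟩ := hBst
  obtain ⟨γ₂, hγ₂, hend⟩ := hE F.m
  set d : ℝ := ((dimSU N : ℕ) : ℝ) with hddef
  have hda : 0 ≤ d - a := by rw [hddef]; linarith
  set κ : ℝ := d - 4 * a with hκdef
  have hκ0 : 0 < κ := by rw [hκdef, hddef]; linarith
  have hdnn : 0 ≤ d := Nat.cast_nonneg _
  -- the number of kept scales
  set j₀ : ℕ := ⌈16 * (d - a) / κ⌉₊ with hj₀def
  have hj₀ : 16 * (d - a) / κ ≤ (j₀ : ℝ) := Nat.le_ceil _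
  have hBp : 0 ≤ max (B j₀) 0 := le_max_right _ _
  -- constants
  set CN : ℝ := ((N * N : ℕ) : ℝ) * Real.log (16 * Real.pi + 1) + Real.log ((2 * N + 1) / (4 * Real.pi)) with hCN
  set C : ℝ := 4 * |CN| + 128 + 4 * (|θ.ν.logσ₀| + Cw) + 2 * (d - a) + 1 with hCdef
  have hCpos : 0 < C := by positivity
  -- the window: `γ ≤ γB, γ₂, γc, e^{−1/2}, e^{−2C/κ}`, and `γ²·max(B j₀,0) ≤ 1/2`
  set γs : ℝ := Real.sqrt (1 / (2 * (max (B j₀) 0 + 1))) with hγs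
  have hγs0 : 0 < γs := Real.sqrt_pos.2 (by positivity)
  set γ : ℝ := min (min (min γB γ₂) (min γc γs)) (min (Real.exp (-(1 / 2))) (Real.exp (-(2 * C / κ)))) with hγdef
  have hγpos : 0 < γ := lt_min (lt_min (lt_min hγB hγ₂) (lt_min hγc hγs0)) (lt_min (Real.exp_pos _) (Real.exp_pos _))
  have hγB' : γ ≤ γB := ((min_le_left _ _).trans (min_le_left _ _)).trans (min_le_left _ _)
  have hγc' : γ ≤ γc := ((min_le_left _ _).trans (min_le_right _ _)).trans (min_le_left _ _)
  have hγs' : γ ≤ γs := ((min_le_left _ _).trans (min_le_right _ _)).trans (min_le_right _ _)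
  have hγhalf : γ ≤ Real.exp (-(1 / 2)) := (min_le_right _ _).trans (min_le_left _ _)
  have hγexp : γ ≤ Real.exp (-(2 * C / κ)) := (min_le_right _ _).trans (min_le_right _ _)
  have hγ1 : γ ≤ 1 := hγhalf.trans (Real.exp_le_one_iff.2 (by norm_num))
  obtain ⟨g, hgpos, hruns⟩ := hend γ hγpos (((min_le_left _ _).trans (min_le_left _ _)).trans (min_le_right _ _))
  have hrun : ∀ K : ℕ, ∃ g0 : ℝ, ((datumOfRecord₁₃SepCoPHV F N θ h v).C ⟨K, F.m, g0⟩).flow.InInterval γ K ∧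
      ((datumOfRecord₁₃SepCoPHV F N θ h v).C ⟨K, F.m, g0⟩).flow.g K = g := fun K => hruns g hgpos le_rfl K
  set R : ℝ := ep g with hRdef
  -- per-`K` inequality
  have hkey : ∀ K : ℕ, 1 ≤ K → j₀ ≤ K → 4 * d / κ ≤ ((F.P K).sitesPerDir 0 : ℝ) → 2 * |R| ≤ ((F.L : ℝ) ^ K) ^ 4 →
      κ / 2 * (2 * C / κ) ≤ C - 1 / 2 := by
    intro K hK hjK hnKge hLK
    obtain ⟨g0, hI, hgK⟩ := hrun K
    have hflow : ((datumOfRecord₁₃SepCoPHV F N θ h v).C ⟨K, F.m, g0⟩).flow.g = gOfRecord₁₃ F N θ.toStage13Params ⟨K, F.m, g0⟩ :=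
      flow_g_datumOfRecord₁₃SepCoPHV F N θ h v ⟨K, F.m, g0⟩
    have hIγ : ∀ k, k ≤ K → 0 < gOfRecord₁₃ F N θ.toStage13Params ⟨K, F.m, g0⟩ k ∧ gOfRecord₁₃ F N θ.toStage13Params ⟨K, F.m, g0⟩ k ≤ γ :=
      fun k hk => by have := hI k hk; rwa [hflow] at this
    have hIc : ∀ k, k ≤ K → 0 < gOfRecord₁₃ F N θ.toStage13Params ⟨K, F.m, g0⟩ k ∧ gOfRecord₁₃ F N θ.toStage13Params ⟨K, F.m, g0⟩ k ≤ γc :=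
      fun k hk => ⟨(hIγ k hk).1, (hIγ k hk).2.trans hγc'⟩
    have hg0 : 0 < g0 ∧ g0 ≤ γ := by
      have := hIγ 0 (Nat.zero_le _)
      rwa [show gOfRecord₁₃ F N θ.toStage13Params ⟨K, F.m, g0⟩ 0 = g0 from genSeq_zero _ _] at this
    -- `log g₀ ≤ −1/2`
    have hlogγ : Real.log g0 ≤ Real.log γ := Real.log_le_log hg0.1 hg0.2
    have hlogg0half : Real.log g0 ≤ -(1 / 2) := by
      have := Real.log_le_log hγpos hγhalf; rw [Real.log_exp] at this; linarith
    -- the kept scales: `log g_j ≤ log g₀ + 1/2` for `j < j₀` (from (H_up) and `g₀² ≤ 1/(2(B⁺_{j₀}+1))`)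
    have hg0sq : g0 ^ 2 * (max (B j₀) 0 + 1) ≤ 1 / 2 := by
      have h1 : g0 ≤ γs := hg0.2.trans hγs'
      have h2 : g0 ^ 2 ≤ γs ^ 2 := pow_le_pow_left₀ hg0.1.le h1 2
      have h3 : γs ^ 2 = 1 / (2 * (max (B j₀) 0 + 1)) := by rw [hγs, Real.sq_sqrt (by positivity)]
      rw [h3] at h2
      have h4 : 0 < max (B j₀) 0 + 1 := by positivity
      calc g0 ^ 2 * (max (B j₀) 0 + 1) ≤ 1 / (2 * (max (B j₀) 0 + 1)) * (max (B j₀) 0 + 1) := mul_le_mul_of_nonneg_right h2 h4.le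
        _ = 1 / 2 := by field_simp
    have hupj : ∀ j, j < j₀ → Real.log (gOfRecord₁₃ F N θ.toStage13Params ⟨K, F.m, g0⟩ j) ≤ Real.log g0 + 1 / 2 := by
      intro j hj
      have hjK' : j ≤ K := (le_of_lt hj).trans hjK
      set gj : ℝ := gOfRecord₁₃ F N θ.toStage13Params ⟨K, F.m, g0⟩ j with hgj
      have hgjpos : 0 < gj := (hIc j hjK').1
      have h1 : 1 / g0 ^ 2 - B j ≤ 1 / gj ^ 2 := by
        have := hup ⟨K, F.m, g0⟩ hIc j hjK'
        simpa [hgj] using this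
      have hBj : B j ≤ max (B j₀) 0 := (hB (le_of_lt hj)).trans (le_max_left _ _)
      -- `1/g_j² ≥ 1/g₀² − B⁺ ≥ 1/(2g₀²)`
      have hg0pos2 : 0 < g0 ^ 2 := pow_pos hg0.1 2
      have h2 : 1 / (2 * g0 ^ 2) ≤ 1 / gj ^ 2 := by
        have h3 : max (B j₀) 0 ≤ 1 / (2 * g0 ^ 2) := by
          rw [le_div_iff₀ (mul_pos two_pos hg0pos2)]; linarith [hg0sq, hg0pos2.le]
        have h4 : 1 / (2 * g0 ^ 2) = 1 / g0 ^ 2 - 1 / (2 * g0 ^ 2) := by field_simp; ring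
        linarith [h1, hBj, h3, h4]
      -- so `g_j² ≤ 2 g₀²` and `log g_j ≤ log g₀ + log 2 / 2 ≤ log g₀ + 1/2`
      have h5 : gj ^ 2 ≤ 2 * g0 ^ 2 := (one_div_le_one_div (mul_pos two_pos hg0pos2) (pow_pos hgjpos 2)).1 h2
      have h6 : 2 * Real.log gj ≤ Real.log 2 + 2 * Real.log g0 := by
        have h7 := Real.log_le_log (pow_pos hgjpos 2) h5
        rw [Real.log_pow, Real.log_mul (by norm_num) hg0pos2.ne', Real.log_pow] at h7
        push_cast at h7
        linarith
      have h8 : Real.log 2 ≤ 1 := le_trans Real.log_two_lt_d9.le (by norm_num)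
      linarith
    -- §1: `E` above
    have hEle := EOfRecord₁₃_le_of_logSlope_keepScales (F := F) θ.toStage13Params ⟨K, F.m, g0⟩ ha hCw j₀ hjK
      (fun j hj h0 h1 => hw ⟨K, F.m, g0⟩ j hj h0 h1) hupj hlogg0half hγ1 hIγ
    dsimp only at hEle
    -- the window's upper half and the axial-layer LOWER bound on `log Z` at `β₀ = g₀⁻² ≥ 1`
    have hwin := log_partitionFn_sub_E_le_of_cor3With F N θ h v hcor K g0 (fun k hk => ⟨(hI k hk).1, (hI k hk).2.trans hγB'⟩)
    have hnum : ((datumOfRecord₁₃SepCoPHV F N θ h v).C ⟨K, F.m, g0⟩).numSites K = Fintype.card (Site (F.P K) K) := rfl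
    rw [hgK, hnum] at hwin
    have hβ : 1 ≤ g0⁻¹ ^ 2 := one_le_pow₀ ((one_le_inv₀ hg0.1).2 (hg0.2.trans hγ1))
    have hZ := log_partitionFn_ge_axialLayers_specialUnitary_d4 N (F.P K) (T4Family.P_d F K) hβ
    rw [← dimSU_cast (N := N), ← hddef, ← hCN] at hZ
    have hlogβ : Real.log (g0⁻¹ ^ 2) = -2 * Real.log g0 := by rw [Real.log_pow, Real.log_inv]; ring
    rw [hlogβ] at hZ
    have hlogg0 : Real.log g0 ≤ -(2 * C / κ) := by
      have := Real.log_le_log hγpos hγexp; rw [Real.log_exp] at this; linarith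
    -- atoms
    set T0 : ℝ := (Fintype.card (Site (F.P K) 0) : ℝ) with hT0
    set nK : ℝ := (Fintype.card (Site (F.P K) K) : ℝ) with hnKdef
    set n : ℝ := ((F.P K).sitesPerDir 0 : ℝ) with hn
    set X : ℝ := -Real.log g0 with hX
    set L4 : ℝ := ((F.L : ℝ) ^ K) ^ 4 with hL4
    set ε : ℝ := (((F.L : ℝ) ^ j₀) ^ 4)⁻¹ with hε
    have hT0eq : T0 = nK * L4 := card_site_zero_eq (F := F) K
    have hnKpos : 0 < nK := card_site_top_pos (F := F) K
    have hL4K : (K : ℝ) ≤ L4 := le_L_pow (F := F) K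
    have hL41 : 1 ≤ L4 := le_trans (by exact_mod_cast hK) hL4K
    have hT0nn : 0 ≤ T0 := Nat.cast_nonneg _
    have hT0pos : 0 < T0 := by rw [hT0eq]; exact mul_pos hnKpos (lt_of_lt_of_le one_pos hL41)
    have hn1 : (1 : ℝ) ≤ n := by rw [hn]; exact_mod_cast Nat.pos_of_ne_zero ((F.P K).sitesPerDir_ne_zero 0)
    have hnpos : 0 < n := lt_of_lt_of_le one_pos hn1
    have hXge : 2 * C / κ ≤ X := by rw [hX]; linarith
    have hXnn : 0 ≤ X := le_trans (div_pos (by positivity) hκ0).le hXge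
    -- `ε = L^{−4j₀}`: `0 ≤ ε` and `4(d−a)ε ≤ κ/4` (from `L^{4j₀} ≥ j₀ ≥ 16(d−a)/κ`)
    have hLj : (j₀ : ℝ) ≤ ((F.L : ℝ) ^ j₀) ^ 4 := le_L_pow (F := F) j₀
    have hεnn : 0 ≤ ε := by positivity
    have hε1 : ε ≤ 1 := by
      rw [hε]; refine inv_le_one_of_one_le₀ ?_
      have : (1 : ℝ) ≤ F.L := by exact_mod_cast (le_of_lt F.hL.2)
      exact one_le_pow₀ (one_le_pow₀ this)
    have hεda : 4 * (d - a) * ε ≤ κ / 4 := by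
      by_cases hda0 : d - a = 0
      · rw [hda0]; linarith [hκ0.le]
      have hdapos : 0 < d - a := lt_of_le_of_ne hda (Ne.symm hda0)
      have hLpos : 0 < ((F.L : ℝ) ^ j₀) ^ 4 := by
        have : (0 : ℝ) < F.L := by exact_mod_cast (lt_trans zero_lt_one F.hL.2)
        positivity
      have h1 : 16 * (d - a) ≤ κ * ((F.L : ℝ) ^ j₀) ^ 4 := by
        have := (div_le_iff₀ hκ0).1 (hj₀.trans hLj)
        linarith
      rw [hε, ← div_eq_mul_inv, div_le_iff₀ hLpos]
      linarith
    -- `d/n ≤ κ/4`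
    have hdn : d * (1 / n) ≤ κ / 4 := by
      have h1 : 4 * d ≤ κ * n := by
        have := (div_le_iff₀ hκ0).1 hnKge
        linarith
      rw [mul_one_div, div_le_iff₀ hnpos]
      linarith
    -- combine the two bounds on `E`: lower (`log Z − ep·nK ≤ E`, p639903) vs §1 upper
    have hcomb : -((3 + 1 / n) * T0) * (d / 2 * (-2 * (-X)) + CN) - 128 * T0 - R * nK ≤
        4 * (d - a) * (-X + 1 / 2) * (1 - ε) * T0 + 4 * (|θ.ν.logσ₀| + Cw) * T0 := by
      have h1 : Real.log (partitionFn (G := SU N) (F.P K) (g0⁻¹ ^ 2)) - R * nK ≤ EOfRecord₁₃ F N θ.toStage13Params ⟨K, F.m, g0⟩ := by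
        rw [hRdef]; linarith [hwin]
      have h2 := le_trans (by linarith [hZ] : -((3 + n⁻¹) * T0) * (d / 2 * (-2 * Real.log g0) + CN) - 128 * T0 - R * nK ≤
        Real.log (partitionFn (G := SU N) (F.P K) (g0⁻¹ ^ 2)) - R * nK) (h1.trans hEle)
      rw [hX, neg_neg, one_div]
      exact h2
    -- `R·nK ≤ |R|·nK ≤ (L4/2)·nK = T0/2`
    have hRle : R * nK ≤ T0 / 2 := by
      rw [hT0eq]
      have h2 : R * nK ≤ |R| * nK := mul_le_mul_of_nonneg_right (le_abs_self R) hnKpos.le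
      have h3 : 2 * |R| * nK ≤ L4 * nK := mul_le_mul_of_nonneg_right hLK hnKpos.le
      linarith [h2, h3]
    -- `(3+1/n)·T0·CN ≤ 4|CN|·T0`
    have hninv1 : 1 / n ≤ 1 := by rw [div_le_one hnpos]; exact hn1
    have hninv0 : 0 ≤ 1 / n := by positivity
    have habs : (3 + 1 / n) * T0 * CN ≤ 4 * |CN| * T0 := by
      have h3 : (3 + 1 / n) * T0 * CN ≤ (3 + 1 / n) * T0 * |CN| := mul_le_mul_of_nonneg_left (le_abs_self CN) (by positivity)
      have h4 : 0 ≤ (1 - 1 / n) * (T0 * |CN|) := mul_nonneg (sub_nonneg.2 hninv1) (mul_nonneg hT0nn (abs_nonneg CN))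
      linarith [h3, h4]
    -- the main linear combination: `[4(1−ε)(d−a) − (3+1/n)d]·X·T0 ≤ (C − 1/2 − ...)·T0`
    -- pieces: `4(d−a)(1−ε)·(1/2) ≤ 2(d−a)`, `4(d−a)ε·X·T0 ≤ (κ/4)·X·T0`, `(d/n)·X·T0 ≤ (κ/4)·X·T0`
    have hp1 : 4 * (d - a) * (1 / 2) * (1 - ε) * T0 ≤ 2 * (d - a) * T0 := by
      have : 0 ≤ (d - a) * ε * T0 := by positivity
      linarith [this]
    have hp2 : 4 * (d - a) * ε * (X * T0) ≤ κ / 4 * (X * T0) := mul_le_mul_of_nonneg_right hεda (mul_nonneg hXnn hT0nn)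
    have hp3 : d * (1 / n) * (X * T0) ≤ κ / 4 * (X * T0) := mul_le_mul_of_nonneg_right hdn (mul_nonneg hXnn hT0nn)
    have hfin : κ / 2 * X * T0 ≤ (C - 1 / 2) * T0 := by
      have e1 : -((3 + 1 / n) * T0) * (d / 2 * (-2 * (-X)) + CN) = -(3 * d * X * T0) - d * (1 / n) * (X * T0) - (3 + 1 / n) * T0 * CN := by ring
      have e2 : 4 * (d - a) * (-X + 1 / 2) * (1 - ε) * T0 =
          -(4 * (d - a) * X * T0) + 4 * (d - a) * ε * (X * T0) + 4 * (d - a) * (1 / 2) * (1 - ε) * T0 := by ring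
      have e3 : 4 * (d - a) * X * T0 = 3 * d * X * T0 + κ * X * T0 := by rw [hκdef]; ring
      rw [e1, e2, e3] at hcomb
      rw [hCdef]
      linarith [hcomb, hRle, habs, hp1, hp2, hp3]
    have hfin' : κ / 2 * X ≤ C - 1 / 2 := le_of_mul_le_mul_right hfin hT0pos
    calc κ / 2 * (2 * C / κ) ≤ κ / 2 * X := mul_le_mul_of_nonneg_left hXge (by linarith)
      _ ≤ C - 1 / 2 := hfin'
  -- choose `K ≥ max(1, j₀, ⌈4d/κ⌉, ⌈2|R|⌉)`
  obtain ⟨K, hK1, hKj, hKn, hKR⟩ : ∃ K : ℕ, 1 ≤ K ∧ j₀ ≤ K ∧ 4 * d / κ ≤ (K : ℝ) ∧ 2 * |R| ≤ (K : ℝ) := by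
    refine ⟨max (max 1 j₀) (max ⌈4 * d / κ⌉₊ ⌈2 * |R|⌉₊), (le_max_left _ _).trans (le_max_left _ _),
      (le_max_right _ _).trans (le_max_left _ _), ?_, ?_⟩
    · have h1 := Nat.le_ceil (4 * d / κ)
      have h2 : (⌈4 * d / κ⌉₊ : ℝ) ≤ ((max (max 1 j₀) (max ⌈4 * d / κ⌉₊ ⌈2 * |R|⌉₊) : ℕ) : ℝ) := by
        exact_mod_cast (le_max_left _ _).trans (le_max_right _ _)
      linarith
    · have h1 := Nat.le_ceil (2 * |R|)
      have h2 : (⌈2 * |R|⌉₊ : ℝ) ≤ ((max (max 1 j₀) (max ⌈4 * d / κ⌉₊ ⌈2 * |R|⌉₊) : ℕ) : ℝ) := by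
        exact_mod_cast (le_max_right _ _).trans (le_max_right _ _)
      linarith
  have h1 := hkey K hK1 hKj (hKn.trans (le_sitesPerDir_zero (F := F) K)) (hKR.trans (le_L_pow (F := F) K))
  have hκne : κ ≠ 0 := hκ0.ne'
  have h2 : κ / 2 * (2 * C / κ) = C := by field_simp
  rw [h2] at h1
  linarith

end NoGo

/-! ## §3. The band collapses: two-sided letters of slope `a` force `4a = d(𝔤)` -/

section Exact

variable (θ : Stage13HParams F N) (h : θ.Provisos₁₃SepCoPH F N) (v : Revision₁₃ F N θ h)

/-- **★★★ THE NORMALISATION SLOPE IS PRINT's `d(𝔤)∕4`.**  TWO-SIDED letters of slope `a` (`|ℓ_p(j) − a·log(1∕g_j)·|T^{(j)*}|| ≤ C_w|T^{(j)*}|`, `a ≤ d(𝔤)`), coupling comparability both ways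
along `γ_c`-windowed runs ((H_cmp): `log g₀ − M′ ≤ log g_j`; (H_up): `g_j⁻² ≥ g₀⁻² − B_j`, `B` non-decreasing), K-uniform last-step small-field floors (H_low), (B) at the revised datum and endpoint
existence ⟹ `4a = d(𝔤)`: §2 excludes `4a < d(𝔤)`, p647277 excludes `4a > d(𝔤)`.  Print's `log z_j = d(𝔤) log g_j + O(1)` ([I] (0.15)) is `a = d(𝔤)∕4`.  LOCATED; nothing asserted or refuted.
[cite: Balaban1988Convergent, Thm 1 p.262, (1.15) p.249, Cor. 3 (2.50) p.264; Balaban1987RG1, Thm 2 p.259, (0.15) p.254] -/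
theorem four_mul_slope_eq_dim_of_endStatementBPrinted_of_endpointExistence {a Cw M' γc : ℝ} {B : ℕ → ℝ} (ha : a ≤ ((dimSU N : ℕ) : ℝ))
    (hCw : 0 ≤ Cw) (hM' : 0 ≤ M') (hγc : 0 < γc) (hB : Monotone B)
    (hw : ∀ (p : B12.RunParams) (j : ℕ), j < p.K → 0 < gOfRecord₁₃ F N θ.toStage13Params p j → gOfRecord₁₃ F N θ.toStage13Params p j ≤ 1 →
      |(-(θ.logz p j) * ((((F.P p.K).L : ℝ) ^ 4 - 1) * sitesCard (F.P p.K) (j + 1)) + θ.Efl p j) -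
          a * (-Real.log (gOfRecord₁₃ F N θ.toStage13Params p j)) * tstarCount (F.P p.K) j| ≤ Cw * tstarCount (F.P p.K) j)
    (hcmp : ∀ p : B12.RunParams, (∀ k, k ≤ p.K → 0 < gOfRecord₁₃ F N θ.toStage13Params p k ∧ gOfRecord₁₃ F N θ.toStage13Params p k ≤ γc) →
      ∀ j, j ≤ p.K → Real.log p.g0 - M' ≤ Real.log (gOfRecord₁₃ F N θ.toStage13Params p j))
    (hup : ∀ p : B12.RunParams, (∀ k, k ≤ p.K → 0 < gOfRecord₁₃ F N θ.toStage13Params p k ∧ gOfRecord₁₃ F N θ.toStage13Params p k ≤ γc) →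
      ∀ j, j ≤ p.K → 1 / p.g0 ^ 2 - B j ≤ 1 / gOfRecord₁₃ F N θ.toStage13Params p j ^ 2)
    (hlow : ∀ g : ℝ, 0 < g → g ≤ γc → ∃ c : ℝ, 0 < c ∧ ∀ (K : ℕ) (g₀ : ℝ),
      (∀ k, k ≤ K → 0 < gOfRecord₁₃ F N θ.toStage13Params ⟨K, F.m, g₀⟩ k ∧ gOfRecord₁₃ F N θ.toStage13Params ⟨K, F.m, g₀⟩ k ≤ γc) →
        gOfRecord₁₃ F N θ.toStage13Params ⟨K, F.m, g₀⟩ K = g → c ≤ smallFieldMass (datumOfRecord₁₃SepCoPHV F N θ h v) K g₀)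
    (hBst : B16.EndStatementBPrinted (datumOfRecord₁₃SepCoPHV F N θ h v).C)
    (hE : DagBinding.EndpointExistence (datumOfRecord₁₃SepCoPHV F N θ h v).C.toB12) :
    4 * a = ((dimSU N : ℕ) : ℝ) := by
  have hupL : ∀ (p : B12.RunParams) (j : ℕ), j < p.K → 0 < gOfRecord₁₃ F N θ.toStage13Params p j → gOfRecord₁₃ F N θ.toStage13Params p j ≤ 1 →
      -(θ.logz p j) * ((((F.P p.K).L : ℝ) ^ 4 - 1) * sitesCard (F.P p.K) (j + 1)) + θ.Efl p j ≤
        (a * (-Real.log (gOfRecord₁₃ F N θ.toStage13Params p j)) + Cw) * tstarCount (F.P p.K) j := by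
    intro p j hj h0 h1; have := (abs_le.1 (hw p j hj h0 h1)).2; linarith
  have hdown : ∀ (p : B12.RunParams) (j : ℕ), j < p.K → 0 < gOfRecord₁₃ F N θ.toStage13Params p j → gOfRecord₁₃ F N θ.toStage13Params p j ≤ 1 →
      (a * (-Real.log (gOfRecord₁₃ F N θ.toStage13Params p j)) - Cw) * tstarCount (F.P p.K) j ≤
        -(θ.logz p j) * ((((F.P p.K).L : ℝ) ^ 4 - 1) * sitesCard (F.P p.K) (j + 1)) + θ.Efl p j := by
    intro p j hj h0 h1; have := (abs_le.1 (hw p j hj h0 h1)).1; linarith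
  rcases lt_trichotomy (4 * a) ((dimSU N : ℕ) : ℝ) with hlt | heq | hgt
  · exact (false_of_endStatementBPrinted_of_endpointExistence_of_logSlope_sharp θ h v ha hlt hCw hγc hB hupL hup hBst hE).elim
  · exact heq
  · exact (false_of_endStatementBPrinted_of_endpointExistence_of_logSlopeLower θ h v ha hgt hCw hM' hγc hdown hcmp hlow hBst hE).elim

end Exact

end Summit.QuantumFields.YangMills.BalabanUVNodes.N13NormalisationSharpLowerSlopeThresholdAtRecord13SepCoPHV

end
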